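import Literature.AlgebraicGeometry.Frobenioids.PadicFrobenioidQp
import Literature.AlgebraicGeometry.Frobenioids.PadicFrobenioidPrimitiveSplit
import Literature.AlgebraicGeometry.Frobenioids.PadicFrobenioidPerfectionMonoid
import Literature.AlgebraicGeometry.Frobenioids.PadicFrobenioidInclusion
import HarnessLib

/-!
# Frobenioids II, Example 1.1 (ii) / Theorem 1.2 (v) for `ℚ_p` over the trivial base: `C^⊢(ℚ_p) ⊆ C(ℚ_p)`, `τ_p` — all hypotheses discharged

Mochizuki, *The geometry of Frobenioids II*, Kyushu J. Math. **62** (2008) 401–460, §1, Example 1.1 (ii) p. 8 and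
Theorem 1.2 (v) p. 9 [cite: MochizukiFrdII2008, Thm 1.2 (v) p.9]; [IUTchI] Ex. 3.3 (i), here at `K_v = ℚ_p` over the
one-object base: "the assignment `Φ_{C_v^⊢} : Spec(L) ↦ ord(ℤ_{p_v}^⊳) (⊆ ord(O_L^⊳)^pf)` determines an absolutely
primitive […] submonoid `Φ_{C_v^⊢} ⊆ Φ_{C_v}|_{D_v^⊢}` on `D_v^⊢`; these monoids `Φ_{C_v^⊢}`, `Φ_{C_v}` determine
`p_v`-adic Frobenioids `C_v^⊢ ⊆ C_v` […]. … the element `p_v ∈ ℤ_{p_v}^⊳ ⊆ O_{K_v}^⊳` determines a characteristic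
splitting `τ_v^⊢` on `C_v^⊢` […]. Write `F_v^⊢ := (C_v^⊢, τ_v^⊢)` for the resulting split Frobenioid." (print's
bracketed cross-references `[cf. …]` elided as `[…]`).

DISCLOSURE (referee finding I5-k on `PadicFrobenioidPerfection.lean`): `Φ_{C_v} = ord(O^⊳)^pf` is typed there as
the submonoid `Realification.perf` of `ord(O^⊳) ⊗ ℝ_{≥0}` (elements with a positive power in the image of
`ord(O^⊳)`), whereas [FrdI] §0 (kurims p. 11) DEFINES `M^pf` as "the inductive limit of the inductive system `I_*`
of monoids `… → M —n·→ M → …`"; for `ℤ`-monoprime `M` both are `≅ ℚ_{≥0}` (`Realification.isQMonoprime_perf`), which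
is the only case instantiated here; the colimit form is typed in abc-iut-L1-d9's `Perfection.lean`.

DE-VACUATION at a concrete base (abc-iut-L1-t4; companion of `PadicFrobenioidQp.lean`'s `datumQp`/`CZeroQp`):
over the one-object base `Spec ℚ_p` (`qpBase`) EVERY hypothesis of the constructions of this directory is
discharged — `p`-adic local (`isPadicLocal_qpFld`), connected, totally epimorphic, of FSM-type
(`isOfFSMType_discretePUnit`):

* `Datum.primQp` / `CDashQp` — the absolutely primitive `p`-adic Frobenioid `C^⊢(ℚ_p)` (`Φ = ℤ_{≥0} · ord(p)
  = ord(ℤ_p^⊳)`), `primQp_isAbsolutelyPrimitive`, `primQp_isMonoidData`;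
* `τQp : CharacteristicSplitting` — the characteristic splitting determined by `p` (Thm. 1.2 (v)), so that
  `(CDashQp, τQp)` is the split Frobenioid `F_v^⊢` at `K_v = ℚ_p`;
* `Datum.perfQp` / `CQp` — the `p`-adic Frobenioid of the perfection `ord(ℤ_p^⊳)^pf` (`C_v`), `perfQp_isMonoidData`;
* `CDashQpToCQp : CDashQp ⥤ CQp` — `C^⊢ ⊆ C`, faithful.
-/

noncomputable section

namespace Literature.AlgebraicGeometry.Frobenioids

namespace PadicFrd

open CategoryTheory Opposite Function

variable (p : ℕ) [Fact p.Prime]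

/-- The one-object base is of FSM-type (its only arrows are identities, hence isomorphisms).
[cite: MochizukiFrdII2008, Ex 1.1 (i) p.7] -/
theorem isOfFSMType_discretePUnit : IsOfFSMType (Discrete PUnit.{1}) :=
  ⟨fun {A B} f _ => by
    obtain ⟨⟨⟩⟩ := A
    obtain ⟨⟨⟩⟩ := B
    exact ⟨⟨𝟙 _, Subsingleton.elim _ _, Subsingleton.elim _ _⟩⟩⟩

/-- **`C^⊢(ℚ_p)`, the datum**: the absolutely primitive `p`-adic Frobenioid datum `Φ = ℤ_{≥0} · ord(p) = ord(ℤ_p^⊳)`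
over the one-object base `Spec ℚ_p` — all hypotheses discharged. [cite: MochizukiFrdII2008, Ex 1.1 (ii) p.8] -/
def Datum.primQp : Datum (Discrete PUnit.{1}) p :=
  Datum.prim (qpBase p) (fun _ => isPadicLocal_qpFld p) inferInstance isTotallyEpimorphic_discretePUnit

/-- `C^⊢(ℚ_p)` as an honest category (a model Frobenioid). [cite: MochizukiFrdII2008, Ex 1.1 (ii) p.8] -/
abbrev CDashQp : Type := (Datum.primQp p).frobenioid

/-- `C^⊢(ℚ_p)` is absolutely primitive. [cite: MochizukiFrdII2008, Ex 1.1 (ii) p.8] -/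
theorem primQp_isAbsolutelyPrimitive : (Datum.primQp p).IsAbsolutelyPrimitive :=
  Datum.prim_isAbsolutelyPrimitive _ _ _ _

/-- "`Φ`, `B` are monoids on `D`" holds for `C^⊢(ℚ_p)` (no residual hypothesis).
[cite: MochizukiFrdII2008, Ex 1.1 (ii) p.8] -/
theorem primQp_isMonoidData : (Datum.primQp p).IsMonoidData :=
  Datum.prim_isMonoidData _ _ _ _ (isOfFSMType_discretePUnit)

/-- **`τ_p` on `C^⊢(ℚ_p)`**: the characteristic splitting determined by `p` (Thm. 1.2 (v)) — `(C^⊢(ℚ_p), τ_p)` is the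
split Frobenioid `F_v^⊢` of [IUTchI] Ex. 3.3 (i) at `K_v = ℚ_p`. [cite: MochizukiFrdII2008, Thm 1.2 (v) p.9] -/
def τQp : PreFrobenioid.CharacteristicSplitting (Datum.primQp p).structureFunctor :=
  Datum.primSplitting _ _ _ _

/-- `C^⊢(ℚ_p)` is of base-trivial type (Thm. 1.2 (v), first clause). [cite: MochizukiFrdII2008, Thm 1.2 (v) p.9] -/
theorem primQp_isOfType_isBaseTrivial :
    PreFrobenioid.IsOfType (PreFrobenioid.IsBaseTrivial (Datum.primQp p).structureFunctor) :=
  Datum.prim_isOfType_isBaseTrivial _ _ _ _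

/-- **`C(ℚ_p)`, the datum**: the `p`-adic Frobenioid of the perfection `ord(ℤ_p^⊳)^pf ≅ ℚ_{≥0}` over `Spec ℚ_p`
(`C_v` of [IUTchI] Ex. 3.3 (i) at `K_v = ℚ_p`). [cite: MochizukiFrdII2008, Ex 1.1 (ii) p.8] -/
def Datum.perfQp : Datum (Discrete PUnit.{1}) p :=
  Datum.perf (qpBase p) (fun _ => isPadicLocal_qpFld p) inferInstance isTotallyEpimorphic_discretePUnit

/-- `C(ℚ_p)` as an honest category. [cite: MochizukiFrdII2008, Ex 1.1 (ii) p.8] -/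
abbrev CQp : Type := (Datum.perfQp p).frobenioid

/-- "`Φ`, `B` are monoids on `D`" holds for `C(ℚ_p)`. [cite: MochizukiFrdII2008, Ex 1.1 (ii) p.8] -/
theorem perfQp_isMonoidData : (Datum.perfQp p).IsMonoidData :=
  Datum.perf_isMonoidData _ _ _ _ (isOfFSMType_discretePUnit)

/-- **`C^⊢(ℚ_p) ⥤ C(ℚ_p)`** ("`C_v^⊢ ⊆ C_v`"). [cite: MochizukiFrdII2008, Ex 1.1 (ii) p.8] -/
def CDashQpToCQp : CDashQp p ⥤ CQp p :=
  Datum.primToPerfFunctor (qpBase p) (fun _ => isPadicLocal_qpFld p) inferInstance isTotallyEpimorphic_discretePUnit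

/-- `C^⊢(ℚ_p) ⥤ C(ℚ_p)` is faithful. [cite: MochizukiFrdII2008, Ex 1.1 (ii) p.8] -/
theorem CDashQpToCQp_faithful : (CDashQpToCQp p).Faithful :=
  Datum.primToPerfFunctor_faithful _ _ _ _

end PadicFrd

end Literature.AlgebraicGeometry.Frobenioids
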